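import Literature.NumberTheory.IwasawaTheory.WeakLeopoldtCyclotomicStages
import Literature.NumberTheory.GaloisCohomology.CyclotomicKillingPrimePower
import Literature.NumberTheory.GaloisRepresentations.RestrictedRamificationInflationTwo
import Literature.NumberTheory.GaloisRepresentations.KummerTwo
import Literature.NumberTheory.EllipticCurves.IwasawaCyclotomicProofs
import HarnessLib

/-!
# Weak Leopoldt for the cyclotomic tower, assembly IV: the Brauer part of a STAGE class dies on a
# deeper STAGE (NSW (10.3.25), proof — front half of the «stagesDie» adapter)

Topic `NumberTheory/IwasawaTheory`; namespace `Literature.NumberTheory.IwasawaTheory`.  Theorems only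
(no definition, no named fact, no instance; D-0026).  Sequel of `WeakLeopoldtCyclotomicStages.lean`
(width seat `bsd-line-x1-p1-w2` gen 8, cell `bsd-eis`, D-0154 (2) INPUTS lane for the named fact
`weakLeopoldt_H2_subsingleton_cyclotomic_of_isOpen`).

Setting: a number field `K`, an odd prime `p`, a set `S` of finite places, an open `U₀ ≤ Γ_K`, the
cyclotomic levels `F_k = ker χ̄_{p^k} = Gal(K̄/K(μ_{p^k}))` and the open subgroups `H_k = U₀ ⊓ F_k`
(`K̄^{H_k} = K′(μ_{p^k})`, `K′ = K̄^{U₀}`), whose images `galoisGroupAbove S H_k = Gal(K_S/K′(μ_{p^k}))`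
are the STAGES of the «stagesDie» tower of `WeakLeopoldtCyclotomicLevels.lean`.

* §1 `exists_forall_resSub_eq_zero_of_isOpen_of_fixes` — the tree's Brauer-killing theorem (A)
  `GaloisCohomology.exists_forall_resSub_mu_primePow_eq_zero_of_le_layerSubgroup` (Serre II §4.4
  Prop. 13 ∘ dévissage; stated for `Gal(K̄/E)`, `E/K` finite) re-addressed to an arbitrary OPEN
  subgroup `H ≤ Γ_K` fixing `μ_p` (`H = Gal(K̄/E)` by the tree's `exists_galFixing_eq_of_isOpen`).
* §2 **`exists_stage_resSub_inflation_eq_zero`** — for `1 ≤ k`, a descended continuous action `ρG` of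
  `Gal(K_S/K′(μ_{p^k}))` on `μ_{p^a}` and a continuous `2`-cocycle `f` of it: there are a deeper level
  `k' ≥ k` and an inflation map `infl : H²(Gal(K_S/K′(μ_{p^k})), μ_{p^a}) → H²(H_k, μ_{p^a})` computed
  on cocycles (the tree's `exists_inflation₂`) such that the RESTRICTION of `infl [f]` to
  `H_{k'} = U₀ ⊓ F_{k'}` VANISHES — (A) at `H_k` for the cyclotomic `ℤ_p`-extension `κ` of `K` (tree
  `EllipticCurves.exists_cyclotomicZpExtension_holds`) gives a layer bound `M`, and the levels
  eventually enter `κ⁻¹(p^M ℤ_p)` (`exists_forall_inf_ker_modNCyclotomicCharacter_le_layerSubgroup`).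
  This is exactly the vanishing hypothesis of the tree's one-stage-down theorem (B)
  `GaloisRepresentations.exists_twoCoboundary_stage_of_resSub_inflation_eq_zero` at `T = H_{k'}`,
  `H = H_k`; the back half of the adapter («stagesDie» verbatim) composes the two with radical descent
  at the open `T` and the coefficient bookkeeping of `WeakLeopoldtCyclotomicStages.lean` §2.

HONEST FRAMING: Galois-cohomological plumbing between landed theorems; no case of weak Leopoldt is
proved here.

References: [NeukirchSchmidtWingberg2008] (10.3.25) (proof), (8.3.11) (ii);
[SerreGaloisCohomology1997] II §4.4 Prop. 13, I §2.4; [Washington1997] §13.1.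
-/

noncomputable section

open scoped Classical
open NumberField IsDedekindDomain Field
open Literature.NumberTheory.GaloisRepresentations
open Literature.NumberTheory.GaloisRepresentations.DiscreteGaloisModule
open Literature.NumberTheory.EllipticCurves (ZpExtension)
open Literature.NumberTheory.IwasawaTheory.Greenberg2006
open _root_.TopRep _root_.ContRepresentation _root_.ContinuousCohomology

namespace Literature.NumberTheory.IwasawaTheory

variable {K : Type} [Field K] [NumberField K] (p : ℕ) [hp : Fact p.Prime]
  (S : Set (HeightOneSpectrum (𝓞 K)))

/-! ### §1. (A) re-addressed to an open subgroup fixing `μ_p` -/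

/-- **Brauer killing on a cyclotomic layer, for an OPEN subgroup `H ≤ Γ_K` fixing `μ_p`**: every
class `y ∈ H²(H, μ_{p^m})` dies on every closed `T ≤ H` with `T ≤ κ⁻¹(p^M ℤ_p)`, for some `M`
(`κ` cyclotomic, `p ≠ 2`).  The tree's `exists_forall_resSub_mu_primePow_eq_zero_of_le_layerSubgroup`
at `E` with `Gal(K̄/E) = H` (`exists_galFixing_eq_of_isOpen`).
[cite: SerreGaloisCohomology1997, II §4.4 Prop. 13 (with Lemme 1)] [cite: NeukirchSchmidtWingberg2008, (10.3.25) (proof)] -/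
theorem exists_forall_resSub_eq_zero_of_isOpen_of_fixes (hp2 : p ≠ 2) {κ : ZpExtension K p}
    (hκ : κ.IsCyclotomic) (m : ℕ) (H : Subgroup (absoluteGaloisGroup K))
    (hH : IsOpen (H : Set (absoluteGaloisGroup K)))
    (hfix : ∀ σ ∈ H, ∀ ζ : rootsOfUnity p (AlgebraicClosure K),
      σ • (ζ : (AlgebraicClosure K)ˣ) = ζ)
    (y : continuousCohomology 2 ((mu K (p ^ m)).restrict (subgroupIncl H)).toTopRep) :
    ∃ M : ℕ, ∀ (T : Subgroup (absoluteGaloisGroup K)) (hTH : T ≤ H),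
      IsClosed (T : Set (absoluteGaloisGroup K)) → T ≤ κ.layerSubgroup M →
        resSub (mu K (p ^ m)) hTH 2 y = 0 := by
  obtain ⟨E, hEfin, hE⟩ := exists_galFixing_eq_of_isOpen H hH
  subst hE
  haveI := hEfin
  obtain ⟨M, hM⟩ := GaloisCohomology.exists_forall_resSub_mu_primePow_eq_zero_of_le_layerSubgroup K
    (Or.inl hp2) hκ m E hfix y
  exact ⟨M, fun T hTH hT hle ↦ by
    haveI : IsClosed (T : Set (absoluteGaloisGroup K)) := hT
    exact hM T hTH hle⟩

/-! ### §2. The Brauer part of a stage class dies on a deeper stage -/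

/-- Elements of `H_k = U₀ ⊓ F_k`, `1 ≤ k`, fix `μ_p`. [cite: Washington1997, §13.1] -/
theorem smul_rootsOfUnity_eq_of_mem_inf_ker (U₀ : Subgroup (absoluteGaloisGroup K)) {k : ℕ}
    (hk : 1 ≤ k) {σ : absoluteGaloisGroup K}
    (hσ : σ ∈ U₀ ⊓ (modNCyclotomicCharacter K (p ^ k)).ker)
    (ζ : rootsOfUnity p (AlgebraicClosure K)) : σ • (ζ : (AlgebraicClosure K)ˣ) = ζ := by
  have hσk : σ ∈ (modNCyclotomicCharacter K (p ^ k)).ker := (Subgroup.mem_inf.mp hσ).2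
  have hζ : ((ζ : (AlgebraicClosure K)ˣ) : AlgebraicClosure K) ^ p ^ k = 1 := by
    obtain ⟨d, hd⟩ := Nat.exists_eq_add_of_le hk
    have h1 : ((ζ : (AlgebraicClosure K)ˣ) : AlgebraicClosure K) ^ p = 1 := by
      have := (mem_rootsOfUnity p (ζ : (AlgebraicClosure K)ˣ)).mp ζ.2
      rw [← Units.val_pow_eq_pow_val, this, Units.val_one]
    rw [hd, pow_add, pow_one, pow_mul, h1, one_pow]
  have h := smul_eq_self_of_mem_ker_modNCyclotomicCharacter p hσk hζ
  exact Units.ext (by rw [Units.coe_smul]; exact h)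

/-- **The Brauer part of a stage class dies on a deeper stage.**  `K` a number field, `p ≠ 2`, `S` a
set of finite places, `U₀ ≤ Γ_K` open, `1 ≤ k`, `H_k := U₀ ⊓ ker χ̄_{p^k}`; `ρG` a continuous action
of the stage `galoisGroupAbove S H_k = Gal(K_S/K′(μ_{p^k}))` on `μ_{p^a}` descending the Galois
action (binder `hρG`, the shape of the tree's (B)-files), `f` a continuous `2`-cocycle of `ρG`
(`hH`: the closedness witness of the open `H_k`, in the binder shape of the (B)-files).  THEN there are `k' ≥ k` and an inflation map `infl : H²(Gal(K_S/K′(μ_{p^k})), μ_{p^a}) → H²(H_k, μ_{p^a})`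
computed on cocycles (tree `exists_inflation₂`) with
`res_{H_{k'}} (infl [f]) = 0` in `H²(H_{k'}, μ_{p^a})`, `H_{k'} = U₀ ⊓ ker χ̄_{p^{k'}}` — the vanishing
hypothesis of the tree's `exists_twoCoboundary_stage_of_resSub_inflation_eq_zero` at `T = H_{k'}`.
Proof: (A) (`exists_forall_resSub_eq_zero_of_isOpen_of_fixes`, cyclotomic `κ` from
`EllipticCurves.exists_cyclotomicZpExtension_holds`) bounds the layer, and the levels eventually enter
it (`exists_forall_inf_ker_modNCyclotomicCharacter_le_layerSubgroup`).
[cite: NeukirchSchmidtWingberg2008, (10.3.25) (proof)] [cite: SerreGaloisCohomology1997, II §4.4 Prop. 13, I §2.4]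
[cite: Washington1997, §13.1] -/
theorem exists_stage_resSub_inflation_eq_zero (hp2 : p ≠ 2)
    (U₀ : Subgroup (absoluteGaloisGroup K)) (hU₀ : IsOpen (U₀ : Set (absoluteGaloisGroup K)))
    {k : ℕ} (hk : 1 ≤ k) {a : ℕ}
    (ρG : ContinuousRep (galoisGroupAbove S (U₀ ⊓ (modNCyclotomicCharacter K (p ^ k)).ker)) ℤ
      (MuCarrier K (p ^ a)))
    (hρG : ∀ (σ : (U₀ ⊓ (modNCyclotomicCharacter K (p ^ k)).ker : Subgroup (absoluteGaloisGroup K)))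
      (v : MuCarrier K (p ^ a)),
      ρG ⟨toUnramifiedQuot K S (σ : absoluteGaloisGroup K), coe_mem_galoisGroupAbove S _ σ⟩ v =
        mu K (p ^ a) (σ : absoluteGaloisGroup K) v)
    (f : contTwoCocycles ρG.toTopRep)
    (hH : IsClosed ((U₀ ⊓ (modNCyclotomicCharacter K (p ^ k)).ker : Subgroup (absoluteGaloisGroup K)) :
      Set (absoluteGaloisGroup K))) :
    haveI : CompactSpace (galoisGroupAbove S (U₀ ⊓ (modNCyclotomicCharacter K (p ^ k)).ker)) :=
      compactSpace_galoisGroupAbove S _ hH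
    ∃ (k' : ℕ) (hkk' : k ≤ k')
      (_ : IsClosed ((U₀ ⊓ (modNCyclotomicCharacter K (p ^ k')).ker : Subgroup (absoluteGaloisGroup K)) :
        Set (absoluteGaloisGroup K)))
      (infl : (continuousCohomology 2 ρG.toTopRep : Type) →+
        (continuousCohomology 2 ((mu K (p ^ a)).restrict
          (subgroupIncl (U₀ ⊓ (modNCyclotomicCharacter K (p ^ k)).ker))).toTopRep : Type)),
      (∀ (f : contTwoCocycles ρG.toTopRep)
          (F : contTwoCocycles ((mu K (p ^ a)).restrict
            (subgroupIncl (U₀ ⊓ (modNCyclotomicCharacter K (p ^ k)).ker))).toTopRep),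
        (∀ σ τ : (U₀ ⊓ (modNCyclotomicCharacter K (p ^ k)).ker : Subgroup (absoluteGaloisGroup K)),
          F.1 (σ, τ) =
            f.1 (⟨toUnramifiedQuot K S (σ : absoluteGaloisGroup K), coe_mem_galoisGroupAbove S _ σ⟩,
              ⟨toUnramifiedQuot K S (τ : absoluteGaloisGroup K), coe_mem_galoisGroupAbove S _ τ⟩)) →
        infl (twoCocycleClass _ f) = twoCocycleClass _ F) ∧
      resSub (mu K (p ^ a))
          (inf_le_inf_left U₀ (ker_modNCyclotomicCharacter_antitone p hkk')) 2
          (infl (twoCocycleClass _ f)) = 0 := by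
  -- topology of the open subgroup `H_k = U₀ ⊓ F_k`
  haveI : CompactSpace (galoisGroupAbove S (U₀ ⊓ (modNCyclotomicCharacter K (p ^ k)).ker)) :=
    compactSpace_galoisGroupAbove S _ hH
  have hHo : IsOpen ((U₀ ⊓ (modNCyclotomicCharacter K (p ^ k)).ker : Subgroup (absoluteGaloisGroup K)) :
      Set (absoluteGaloisGroup K)) :=
    hU₀.inter (isOpen_ker_modNCyclotomicCharacter p k)
  -- the inflation map computed on cocycles
  obtain ⟨infl, hinfl⟩ := exists_inflation₂ S _ hH ρG hρG
  -- the cyclotomic `ℤ_p`-extension and the Brauer-killing layer bound for `infl [f]`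
  obtain ⟨κ, hκ⟩ := Literature.NumberTheory.EllipticCurves.exists_cyclotomicZpExtension_holds K p
  have hfix : ∀ σ ∈ U₀ ⊓ (modNCyclotomicCharacter K (p ^ k)).ker,
      ∀ ζ : rootsOfUnity p (AlgebraicClosure K), σ • (ζ : (AlgebraicClosure K)ˣ) = ζ :=
    fun σ hσ ζ ↦ smul_rootsOfUnity_eq_of_mem_inf_ker p U₀ hk hσ ζ
  obtain ⟨M, hM⟩ := exists_forall_resSub_eq_zero_of_isOpen_of_fixes p hp2 hκ a _ hHo hfix
    (infl (twoCocycleClass _ f))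
  -- the levels eventually enter the layer
  obtain ⟨k₀, hk₀⟩ := exists_forall_inf_ker_modNCyclotomicCharacter_le_layerSubgroup p hκ U₀ M
  have hT : IsClosed ((U₀ ⊓ (modNCyclotomicCharacter K (p ^ max k k₀)).ker :
      Subgroup (absoluteGaloisGroup K)) : Set (absoluteGaloisGroup K)) :=
    (Subgroup.isClosed_of_isOpen U₀ hU₀).inter
      (Subgroup.isClosed_of_isOpen _ (isOpen_ker_modNCyclotomicCharacter p (max k k₀)))
  refine ⟨max k k₀, le_max_left k k₀, hT, infl, hinfl, ?_⟩
  exact hM _ _ hT (hk₀ _ (le_max_right k k₀))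

end Literature.NumberTheory.IwasawaTheory

end
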